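import Summits.NavierStokesRegularity.NavierStokesRegularity.Theses.AxisymmetricExtremality
import Literature.Analysis.FluidPDE.AxisymHouLiVariables
import Literature.Analysis.FluidPDE.SuitableWeakProofs
import HarnessLib

/-!
# Three small tools of Seregin 2022, §2 (Steps 1 and 3): the smallness radius, the pointwise
# use of (2.2), and the singularity-free slab above a singularity-free slice —
# crux stmt-NavierStokesRegularity-15453 (`AxisymmetricExtremality.AxisymmetricKatoGlobal`), line registered, support for stub `stub_sereginLogSwirlOrigin`

Support file (`--supports stmt-NavierStokesRegularity-15453`; theorems only, everything proved)
toward the registered stub `stub_sereginLogSwirlOrigin` = the named fact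
`Literature.Analysis.FluidPDE.seregin2022_logSwirl_regularAtOrigin` (G. Seregin, J. Math. Fluid
Mech. 24 (2022), Paper 27 = arXiv:2201.00153, §2). Three elementary inputs of that proof:

* `exists_radius_logSmall` (**Step 3**, arXiv p. 7: "Here, it is assumed that a number
  `r₁ ∈ ]0,1/4[` so small as `cC₁/ln(e/r₁) + cC₁²/ln⁴(e/|r₁|) < 2`."): for all real `c`, `C₁`
  there is `r₁ ∈ ]0, 1/4[` with `cC₁/ln(e/r) + cC₁²/ln⁴(e/r) < 2` for every `0 < r ≤ r₁`
  (explicit witness `r₁ = min (1/8) (exp (-(|cC₁| + |cC₁²|)))`, since `ln(e/r) = 1 - ln r`).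
* `abs_swirlVelocity_le_of_swirl_le`, `abs_swirlVelocity_div_cylRadius_le_of_swirl_le`,
  `abs_angVelQuot_le_of_swirl_le` (**Step 3**, the pointwise use of (2.2)
  `|σ| = r|v_θ| ≤ C₁/ln³(e/r)` in the estimates of `B₃` and `A₀`): off the axis,
  `|v_θ| ≤ C₁/(r ln³(e/r))` and `|v_θ/r| ≤ C₁/(r² ln³(e/r))`; here `v_θ = swirlVelocity`,
  `σ = swirl = r v_θ` (`swirl_eq_cylRadius_mul_swirlVelocity`), and `v_θ/r` is either the honest
  quotient `swirlVelocity u x / cylRadius x` or the smooth Hou–Li variable `angVelQuot u`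
  (`= swirl u / r²` for axisymmetric `u ∈ C²`, `IsAxisymmetric.cylRadius_sq_mul_angVelQuot`).
* `exists_slab_subset_of_slice_subset`, `exists_slab_disjoint_of_slice_disjoint'`,
  `exists_slab_disjoint_of_slice_disjoint` (registered form, `X = ℝ³`),
  `exists_slab_forall_isRegularPoint` (**Step 1**, arXiv p. 5: "one can find `t₀ ∈ ]-δ², 0[`
  such that there is no singular point in the set `𝒞̄(r₀) × [t₀, t₀ + δ₀²]`"): the tube lemma —
  if a set `S ⊆ ℝ × X` is relatively closed in an open `O` (`closure S ∩ O ⊆ S`, e.g. a singular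
  set, `closure_singularSet_inter_subset`), `K ⊆ X` is compact, and the slice `{t₀} × K` lies in
  `O` and misses `S` (such slices exist by `exists_forall_not_mem_slice_of_isParabolicNull`), then
  a whole slab `[t₀ - δ₀², t₀ + δ₀²] × K` (a fortiori `[t₀, t₀ + δ₀²] × K`) lies in `O` and misses
  `S` (`generalized_tube_lemma` applied to the open set `O ∖ closure S`).

## References

* G. Seregin, J. Math. Fluid Mech. 24 (2022), Paper No. 27 = arXiv:2201.00153, §2 Steps 1, 3
  (arXiv pp. 5–7). [`Seregin2022LocalAxisym`]
-/

noncomputable section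

open Set Filter Topology Function Metric
open Literature.Analysis.FluidPDE

-- `<Problem> = <Summit>` duplicates a namespace component by design (lakefile sets the same option).
set_option linter.dupNamespace false

namespace Summit.NavierStokesRegularity.NavierStokesRegularity.Theorems.AxisymmetricKatoGlobal.EulerScaling

/-! ### Step 3: the smallness radius `r₁` -/

/-- **Seregin 2022, §2 Step 3, the choice of `r₁`** ("it is assumed that a number `r₁ ∈ ]0,1/4[`
so small as `cC₁/ln(e/r₁) + cC₁²/ln⁴(e/|r₁|) < 2`"): since `ln(e/r) = 1 - ln r → +∞` as
`r → 0⁺`, for all real `c, C₁` some `r₁ ∈ ]0, 1/4[` makes `cC₁/ln(e/r) + cC₁²/ln⁴(e/r) < 2` for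
every `0 < r ≤ r₁`; explicitly `r₁ = min (1/8) (exp (-(|cC₁| + |cC₁²|)))`, for which
`ln(e/r) ≥ 1 + |cC₁| + |cC₁²|`. [cite: Seregin2022LocalAxisym, §2 Step 3 (arXiv:2201.00153 p. 7)] -/
theorem exists_radius_logSmall : ∀ (c C₁ : ℝ), ∃ r₁ ∈ Set.Ioo (0:ℝ) (1/4), ∀ r ∈ Set.Ioc 0 r₁, c * C₁ / Real.log (Real.exp 1 / r) + c * C₁ ^ 2 / Real.log (Real.exp 1 / r) ^ 4 < 2 := by
  intro c C₁
  set A : ℝ := |c * C₁| + |c * C₁ ^ 2| with hA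
  have hA0 : 0 ≤ A := by positivity
  refine ⟨min (1 / 8) (Real.exp (-A)), ⟨by positivity, (min_le_left _ _).trans_lt (by norm_num)⟩,
    ?_⟩
  rintro r ⟨hr0, hr1⟩
  have hlogr : Real.log r ≤ -A := by
    have h := Real.log_le_log hr0 (hr1.trans (min_le_right _ _))
    rwa [Real.log_exp] at h
  have hL : Real.log (Real.exp 1 / r) = 1 - Real.log r := by
    rw [Real.log_div (Real.exp_pos 1).ne' hr0.ne', Real.log_exp]
  set L := Real.log (Real.exp 1 / r) with hLdef
  have hL1 : 1 + A ≤ L := by rw [hL]; linarith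
  have hL0 : 0 < L := by linarith
  have hLle : L ≤ L ^ 4 := by
    calc L = L * 1 ^ 3 := by ring
      _ ≤ L * L ^ 3 := by gcongr; linarith
      _ = L ^ 4 := by ring
  have h1 : c * C₁ / L ≤ |c * C₁| / L := by gcongr; exact le_abs_self _
  have h2 : c * C₁ ^ 2 / L ^ 4 ≤ |c * C₁ ^ 2| / L :=
    calc c * C₁ ^ 2 / L ^ 4 ≤ |c * C₁ ^ 2| / L ^ 4 := by gcongr; exact le_abs_self _
      _ ≤ |c * C₁ ^ 2| / L := div_le_div_of_nonneg_left (abs_nonneg _) hL0 hLle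
  have h3 : (|c * C₁| + |c * C₁ ^ 2|) / L < 2 := by
    rw [div_lt_iff₀ hL0]
    linarith
  calc c * C₁ / L + c * C₁ ^ 2 / L ^ 4 ≤ |c * C₁| / L + |c * C₁ ^ 2| / L := add_le_add h1 h2
    _ = (|c * C₁| + |c * C₁ ^ 2|) / L := (add_div _ _ _).symm
    _ < 2 := h3

/-! ### Step 3: the pointwise use of (2.2) -/

/-- **Seregin 2022, §2 Step 3, (2.2) on `v_θ`**: off the axis, `|σ| = r|v_θ| ≤ C₁/ln³(e/r)`
gives `|v_θ| ≤ C₁/(r ln³(e/r))` (`σ = swirl u`, `v_θ = swirlVelocity u`, `r = cylRadius x`; used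
in the bound of `B₃ = -2∫ (v_θ/r)(η³Φ)(η³Γ)`). [cite: Seregin2022LocalAxisym, §2 Step 3, estimate of B₃ via (2.2) (arXiv:2201.00153 p. 6)] -/
theorem abs_swirlVelocity_le_of_swirl_le : ∀ (u : EuclideanSpace ℝ (Fin 3) → EuclideanSpace ℝ (Fin 3)) (x : EuclideanSpace ℝ (Fin 3)) (C₁ : ℝ), 0 < cylRadius x → |swirl u x| ≤ C₁ / Real.log (Real.exp 1 / cylRadius x) ^ 3 → |swirlVelocity u x| ≤ C₁ / (cylRadius x * Real.log (Real.exp 1 / cylRadius x) ^ 3) := by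
  intro u x C₁ hr hσ
  have hsv : swirlVelocity u x = swirl u x / cylRadius x := by
    rw [swirl_eq_cylRadius_mul_swirlVelocity u hr.ne', mul_div_cancel_left₀ _ hr.ne']
  rw [hsv, abs_div, abs_of_pos hr, mul_comm, ← div_div]
  exact div_le_div_of_nonneg_right hσ hr.le

/-- **Seregin 2022, §2 Step 3, (2.2) on `v_θ/r` (honest quotient)**: off the axis,
`|σ| ≤ C₁/ln³(e/r)` gives `|v_θ/r| ≤ C₁/(r² ln³(e/r))` (used in the bound of `A₀` with the
weight `1/(r² ln⁶(e/|x'|))`). [cite: Seregin2022LocalAxisym, §2 Step 3, estimate of A₀ via (2.2) (arXiv:2201.00153 p. 6)] -/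
theorem abs_swirlVelocity_div_cylRadius_le_of_swirl_le
    (u : EuclideanSpace ℝ (Fin 3) → EuclideanSpace ℝ (Fin 3)) {x : EuclideanSpace ℝ (Fin 3)}
    {C₁ : ℝ} (hr : 0 < cylRadius x)
    (hσ : |swirl u x| ≤ C₁ / Real.log (Real.exp 1 / cylRadius x) ^ 3) :
    |swirlVelocity u x / cylRadius x| ≤
      C₁ / (cylRadius x ^ 2 * Real.log (Real.exp 1 / cylRadius x) ^ 3) := by
  have h := abs_swirlVelocity_le_of_swirl_le u x C₁ hr hσ
  rw [abs_div, abs_of_pos hr, pow_two, mul_assoc, mul_comm (cylRadius x) (_ * _), ← div_div]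
  exact div_le_div_of_nonneg_right h hr.le

/-- **Seregin 2022, §2 Step 3, (2.2) on `v_θ/r` (smooth Hou–Li variable)**: for an axisymmetric
`u ∈ C²`, `angVelQuot u = σ/r²` off the axis (`IsAxisymmetric.cylRadius_sq_mul_angVelQuot`), so
`|σ| ≤ C₁/ln³(e/r)` gives `|angVelQuot u x| ≤ C₁/(r² ln³(e/r))`. [cite: Seregin2022LocalAxisym, §2 Step 3, estimate of A₀ via (2.2) (arXiv:2201.00153 p. 6)] -/
theorem abs_angVelQuot_le_of_swirl_le
    {u : EuclideanSpace ℝ (Fin 3) → EuclideanSpace ℝ (Fin 3)} (hax : IsAxisymmetric u)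
    (hu : ContDiff ℝ 2 u) {x : EuclideanSpace ℝ (Fin 3)} {C₁ : ℝ} (hr : 0 < cylRadius x)
    (hσ : |swirl u x| ≤ C₁ / Real.log (Real.exp 1 / cylRadius x) ^ 3) :
    |angVelQuot u x| ≤ C₁ / (cylRadius x ^ 2 * Real.log (Real.exp 1 / cylRadius x) ^ 3) := by
  have hr2 : 0 < cylRadius x ^ 2 := pow_pos hr 2
  have hq : angVelQuot u x = swirl u x / cylRadius x ^ 2 := by
    rw [← hax.cylRadius_sq_mul_angVelQuot hu x, mul_div_cancel_left₀ _ hr2.ne']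
  rw [hq, abs_div, abs_of_pos hr2, mul_comm, ← div_div]
  exact div_le_div_of_nonneg_right hσ hr2.le

/-! ### Step 1: a singularity-free slab above a singularity-free slice -/

/-- **Tube lemma, slab form**: if `W ⊆ ℝ × X` is open, `K ⊆ X` compact and the slice `{t₀} × K`
lies in `W`, then so does a slab `[t₀ - δ₀², t₀ + δ₀²] × K`, `δ₀ > 0`
(`generalized_tube_lemma` for the compact sets `{t₀}` and `K`). [folklore] -/
theorem exists_slab_subset_of_slice_subset {X : Type*} [TopologicalSpace X] {W : Set (ℝ × X)}
    (hW : IsOpen W) {K : Set X} (hK : IsCompact K) {t₀ : ℝ} (h : ({t₀} : Set ℝ) ×ˢ K ⊆ W) :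
    ∃ δ₀ : ℝ, 0 < δ₀ ∧ Set.Icc (t₀ - δ₀ ^ 2) (t₀ + δ₀ ^ 2) ×ˢ K ⊆ W := by
  obtain ⟨U, V, hU, -, htU, hKV, hUV⟩ := generalized_tube_lemma isCompact_singleton hK hW h
  obtain ⟨ε, hε, hball⟩ := Metric.isOpen_iff.1 hU t₀ (htU (mem_singleton t₀))
  refine ⟨Real.sqrt (ε / 2), Real.sqrt_pos.2 (half_pos hε), ?_⟩
  rw [Real.sq_sqrt (half_pos hε).le]
  rintro ⟨t, x⟩ ⟨ht, hx⟩
  refine hUV ⟨hball ?_, hKV hx⟩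
  rw [Metric.mem_ball, Real.dist_eq, abs_lt]
  constructor <;> linarith [ht.1, ht.2]

/-- **A singularity-free slab above a singularity-free slice** (general form of Seregin 2022,
§2 Step 1: "one can find `t₀ ∈ ]-δ², 0[` such that there is no singular point in the set
`𝒞̄(r₀) × [t₀, t₀ + δ₀²]`"): if `S ⊆ ℝ × X` is relatively closed in the open set `O`
(`closure S ∩ O ⊆ S`; for singular sets this is `closure_singularSet_inter_subset`), `K ⊆ X` is
compact, and the slice `{t₀} × K` lies in `O` and misses `S`, then some slab
`[t₀ - δ₀², t₀ + δ₀²] × K`, `δ₀ > 0`, lies in `O` and misses `S` (the tube lemma in the open set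
`O ∖ closure S`). [cite: Seregin2022LocalAxisym, §2 Step 1 (arXiv:2201.00153 p. 5)] -/
theorem exists_slab_disjoint_of_slice_disjoint' {X : Type*} [TopologicalSpace X]
    {S O : Set (ℝ × X)} (hO : IsOpen O) (hS : closure S ∩ O ⊆ S) {K : Set X} (hK : IsCompact K)
    {t₀ : ℝ} (hKO : ({t₀} : Set ℝ) ×ˢ K ⊆ O) (hKS : ({t₀} : Set ℝ) ×ˢ K ∩ S = ∅) :
    ∃ δ₀ : ℝ, 0 < δ₀ ∧ Set.Icc (t₀ - δ₀ ^ 2) (t₀ + δ₀ ^ 2) ×ˢ K ⊆ O ∧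
      Set.Icc (t₀ - δ₀ ^ 2) (t₀ + δ₀ ^ 2) ×ˢ K ∩ S = ∅ := by
  have hW : IsOpen (O \ closure S) := hO.sdiff isClosed_closure
  have hsub : ({t₀} : Set ℝ) ×ˢ K ⊆ O \ closure S := fun z hz =>
    ⟨hKO hz, fun hzc => (eq_empty_iff_forall_notMem.1 hKS) z ⟨hz, hS ⟨hzc, hKO hz⟩⟩⟩
  obtain ⟨δ₀, hδ₀, hslab⟩ := exists_slab_subset_of_slice_subset hW hK hsub
  exact ⟨δ₀, hδ₀, fun z hz => (hslab hz).1,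
    eq_empty_iff_forall_notMem.2 fun z hz => (hslab hz.1).2 (subset_closure hz.2)⟩

/-- **Seregin 2022, §2 Step 1, the singularity-free slab** ("one can find `t₀ ∈ ]-δ², 0[` such
that there is no singular point in the set `𝒞̄(r₀) × [t₀, t₀ + δ₀²]`"), as the topological
statement actually used, on `ℝ × ℝ³`: if `S` is relatively closed in the open set `O`
(`closure S ∩ O ⊆ S`, e.g. `S` = the singular set of the solution in `O = 𝒞 × ]-1, 0[`,
`closure_singularSet_inter_subset`), `K` is compact (e.g. `K = 𝒞̄(r₀)`, `r₀ < 1`), and the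
slice `{t₀} × K ⊆ O` misses `S` (`exists_forall_not_mem_slice_of_isParabolicNull`), then for some
`δ₀ > 0` the slab `[t₀, t₀ + δ₀²] × K` lies in `O` and contains no point of `S`.
[cite: Seregin2022LocalAxisym, §2 Step 1 (arXiv:2201.00153 p. 5)] -/
theorem exists_slab_disjoint_of_slice_disjoint : ∀ (S O : Set (ℝ × EuclideanSpace ℝ (Fin 3))) (K : Set (EuclideanSpace ℝ (Fin 3))) (t₀ : ℝ), IsOpen O → closure S ∩ O ⊆ S → IsCompact K → ({t₀} : Set ℝ) ×ˢ K ⊆ O → ({t₀} : Set ℝ) ×ˢ K ∩ S = ∅ → ∃ δ₀ : ℝ, 0 < δ₀ ∧ Set.Icc t₀ (t₀ + δ₀ ^ 2) ×ˢ K ⊆ O ∧ Set.Icc t₀ (t₀ + δ₀ ^ 2) ×ˢ K ∩ S = ∅ := by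
  intro S O K t₀ hO hS hK hKO hKS
  obtain ⟨δ₀, hδ₀, hO', hS'⟩ := exists_slab_disjoint_of_slice_disjoint' hO hS hK hKO hKS
  have hmono : Set.Icc t₀ (t₀ + δ₀ ^ 2) ×ˢ K ⊆ Set.Icc (t₀ - δ₀ ^ 2) (t₀ + δ₀ ^ 2) ×ˢ K :=
    prod_mono (Icc_subset_Icc_left (by nlinarith [sq_nonneg δ₀])) Subset.rfl
  exact ⟨δ₀, hδ₀, hmono.trans hO', subset_eq_empty (inter_subset_inter_left S hmono) hS'⟩

/-- **The slab of regular points** (Seregin 2022, §2 Step 1, for the singular set of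
Caffarelli–Kohn–Nirenberg, `singularSet u Q`): if `Q ⊆ ℝ × ℝ³` is open, `K` compact, and every
point of the slice `{t₀} × K ⊆ Q` is a regular point of `u`, then every point of some slab
`[t₀ - δ₀², t₀ + δ₀²] × K ⊆ Q`, `δ₀ > 0`, is a regular point of `u` (the regular set is open,
`isOpen_setOf_isRegularPoint_holds`). [cite: Seregin2022LocalAxisym, §2 Step 1 (arXiv:2201.00153 p. 5)] -/
theorem exists_slab_forall_isRegularPoint
    {u : ℝ → EuclideanSpace ℝ (Fin 3) → EuclideanSpace ℝ (Fin 3)}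
    {Q : Set (ℝ × EuclideanSpace ℝ (Fin 3))} (hQ : IsOpen Q) {K : Set (EuclideanSpace ℝ (Fin 3))}
    (hK : IsCompact K) {t₀ : ℝ} (hKQ : ∀ x ∈ K, (t₀, x) ∈ Q)
    (hreg : ∀ x ∈ K, IsRegularPoint u (t₀, x)) :
    ∃ δ₀ : ℝ, 0 < δ₀ ∧ ∀ t ∈ Set.Icc (t₀ - δ₀ ^ 2) (t₀ + δ₀ ^ 2), ∀ x ∈ K,
      (t, x) ∈ Q ∧ IsRegularPoint u (t, x) := by
  have hW : IsOpen (Q ∩ {z : ℝ × EuclideanSpace ℝ (Fin 3) | IsRegularPoint u z}) :=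
    hQ.inter (isOpen_setOf_isRegularPoint_holds u)
  have hsub : ({t₀} : Set ℝ) ×ˢ K ⊆ Q ∩ {z : ℝ × EuclideanSpace ℝ (Fin 3) | IsRegularPoint u z} := by
    rintro ⟨t, x⟩ ⟨ht, hx⟩
    rw [mem_singleton_iff] at ht
    subst ht
    exact ⟨hKQ x hx, hreg x hx⟩
  obtain ⟨δ₀, hδ₀, hslab⟩ := exists_slab_subset_of_slice_subset hW hK hsub
  exact ⟨δ₀, hδ₀, fun t ht x hx => hslab (mk_mem_prod ht hx)⟩

end Summit.NavierStokesRegularity.NavierStokesRegularity.Theorems.AxisymmetricKatoGlobal.EulerScaling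

end
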